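import Literature.Analysis.FluidPDE.EyinkLocalFourFifths
import Literature.Analysis.FluidPDE.DuchonRobertUniformDefect
import HarnessLib

/-!
# Uniform Eyink defects and the local 4/5 and 8/15 laws: from mollified limits to shell limits

Topic: Analysis/FluidPDE, proofs about the notions of `Literature.Analysis.FluidPDE.EyinkLocalFourFifths`
(Eyink's mollified longitudinal/transverse fluxes `Torus.eyinkLongitudinalApprox`,
`Torus.eyinkTransverseApprox`, the sphere averages `Torus.longitudinalFluxSphereAvg`,
`Torus.mixedFluxSphereAvg`) and of `Literature.Analysis.FluidPDE.DissipationAnomaly` (the predicate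
`Torus.HasFourFifthsLaw`, constant `Torus.fourFifthsConst d = 12/(d(d+2))`), on top of the
plateau-mollifier machinery of `Literature.Analysis.FluidPDE.DuchonRobertUniformDefect`
(`Torus.IsUnitBallMollifier`, `Torus.plateauMollifier`, `Torus.HasUniformDuchonRobertDefect.hasFourThirdsLaw`).
Everything here is proved; the only new notions are `Torus.IsRadialUnitBallMollifier`,
`Torus.HasUniformEyinkDefect` and the auxiliary `Torus.cubicShellPairing`.

## Why this file exists

Eyink 2003, Thm. 1 proves, for `u ∈ L³` a weak Euler solution and `φ` a *spherically symmetric*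
mollifier, that the mollified fluxes `D_L^ε(u)`, `D_T^ε(u)` converge in `𝒟'` to the Duchon–Robert
defect `D(u)`; Cor. 1 identifies the shell limits `S_L = −(4/5) D`, `S_T = −(8/15) D` **assuming they
exist** (the tree's `Torus.eq_of_tendsto_eyinkApprox`, `…fourFifthsLaw_of_limits`). Novack 2024,
Thm. 1 removes the assumption. As for the 4/3 law (`DuchonRobertUniformDefect`), what upgrades the
mollified limits to the shell limits is a **uniformity in the mollifier**, which Eyink's proof
supplies (his bounds `‖u_L^ε − u/3‖_{L³} ≤ ∫ φ^ε(ℓ) ‖u(·+ℓ) − u‖_{L³} dℓ`, (norm-uL-thirdu), and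
(norm-pT-twothirdp) depend on `φ` only through its support radius). This file isolates that
uniformity (`HasUniformEyinkDefect`) and proves that it implies **both** the local 4/5 law and the
local 8/15 law, in every dimension `d ≥ 2`, with the constants `−12/(d(d+2))` and
`−4(d−1)/(d(d+2))` of Novack 2024, (1.6b–c) / `Torus.fourFifthsConst`.

## Proof architecture (`HasUniformEyinkDefect.tendsto_shellPairings`)

Fix a test function `ψ`; let `g_L(r) = r⁻¹ ∫∫⟨(δu_L)³⟩_{ang}(r) ψ`, `g_T(r) = r⁻¹ ∫∫⟨δu_L|δu_T|²⟩_{ang}(r) ψ`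
(continuous on `(0,∞)`: `continuous_cubicShellPairing`, continuity of translation in `L³` along
sphere shears as in `DuchonRobertUniformDefect`), and `A(ε) = ∫₀¹ x^{d-1} g_T(εx) dx`.

1. For the plateau mollifiers `φ_m` (radial, unit ball) the proved polar formula
   `Torus.integral_eyinkApprox_eq` and the un-averaging lemmas
   (`tendsto_integral_pow_mul_deriv_profile_mul`, `tendsto_integral_plateauMollifier_profile_mul`)
   give, as `m → ∞` at fixed `ε`,
   `∫∫ D_L^{ε,φ_m} ψ → (d²/4)[−g_L(ε) + 2A(ε)]`, `∫∫ D_T^{ε,φ_m} ψ → (d²/(4(d−1)))[−g_T(ε) − 2A(ε)]`.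
2. Uniformity in `m` of the `ε → 0⁺` limits then yields the two relations
   `−g_L + 2A → (4/d²) D ψ` and `g_T + 2A → −(4(d−1)/d²) D ψ` (`tendsto_nhdsGT_of_forall_tendsto_atTop`).
3. **A Volterra step** (`tendsto_volterra`): if `g` is continuous on `(0,∞)` with `r^{d-1} g(r)`
   bounded near `0` and `g(ε) + 2∫₀¹ x^{d-1} g(εx) dx → 0`, then `∫₀¹ x^{d-1} g(εx) dx → 0` (hence
   `g → 0`): with `H(ε) = ∫₀^ε r^{d-1} g`, `(ε² H)' = ε^{d+1}(g + 2ε^{-d}H)`, so `|ε²H(ε)| ≤ η ε^{d+2}/(d+2)`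
   eventually. Applied to `g = g_T − L_T`, `L_T = −(4(d−1)/(d(d+2))) D ψ`, it gives `g_T → L_T`
   (the 8/15 law), `A → L_T/d`, and then `g_L → 2L_T/d − (4/d²) D ψ = −(12/(d(d+2))) D ψ` (the 4/5 law).
   (Here `d ≥ 2` enters: `r^{d-1} g_T(r) = r^{d-2} ∫∫⟨δu_L|δu_T|²⟩ψ` is bounded near `0`.)

This route differs from Novack's printed Step 2 (which eliminates the ball term `A` with an
auxiliary non-unit-mass kernel `ζ`); it needs only radial unit-ball mollifiers, i.e. exactly the
uniform form of Eyink's Thm. 1.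

## Design notes

* `HasUniformEyinkDefect` mirrors `HasUniformDuchonRobertDefect`: `TendstoUniformlyOn` along
  `𝓝[>] 0`, uniform over `{φ | IsRadialUnitBallMollifier φ}`, for both approximants; metric forms
  both ways.
* `cubicShellPairing Q T u ψ r = ∫_{(0,T)×T^d} ⨍ Q(ω, δu(t,x;rω)) dω ψ` generalises
  `Torus.energyFluxShellPairing` to any cubic form `Q` (Lipschitz on bounded sets, cubically); its
  continuity in `r` is proved once and specialised to `Q_L(ω,v) = ⟪v,ω⟫³`, `Q_T(ω,v) = ⟪v,ω⟫|v − ⟪v,ω⟫ω|²`.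
* Hypotheses of the main theorems: `2 ≤ card d`, joint measurability of the space–time lift and
  `∫⁻₍₀,T₎∫⁻ ‖u‖ₑ³ < ∞` (as in `DuchonRobertUniformDefect`); no Euler equation.

## References

* G. L. Eyink, *Local 4/5-law and energy dissipation anomaly in turbulence*, Nonlinearity 16
  (2003) 137–145 = arXiv:nlin/0208004: §2 Thm. 1 and its proof (the uniform bounds
  (norm-uL-thirdu), (norm-pT-twothirdp)), Cor. 1 and its proof ((en-L-eq), (en-T-eq), the linear
  system (L-eq), (T-eq)). [Eyink2003]
* M. Novack, *Scaling laws and exact results in turbulence*, Nonlinearity 37 (2024) 095002 =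
  arXiv:2310.01375: Thm. 1, (1.6b)–(1.6c) (the unconditional laws and their constants), §2 Step 2.
  [Novack2024]
* Mathlib: `intervalIntegral.integral_hasDerivAt_right`, `intervalIntegral.integral_eq_sub_of_hasDerivAt`
  (the Volterra step), `MeasureTheory.tendsto_integral_of_dominated_convergence`,
  `Measure.toSphere_real_apply_univ`.
-/

noncomputable section

open MeasureTheory MeasureTheory.Measure TopologicalSpace Set Function Filter Topology Metric Module
open scoped InnerProductSpace RealInnerProductSpace ENNReal NNReal

namespace Literature.Analysis.FluidPDE.Torus

variable {d : Type*} [Fintype d]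

/-! ## Radial unit-ball mollifiers and uniform Eyink defects -/

section Uniform

/-- The class of **spherically symmetric mollifiers supported in the closed unit ball** (Eyink
2003, Thm. 1: "`φ` any `C^∞` function with compact support, nonnegative with unit integral,
spherically symmetric", normalised to the unit ball as in `Torus.IsUnitBallMollifier`). [cite: Eyink2003, §2 Thm. 1] -/
def IsRadialUnitBallMollifier (φ : EuclideanSpace ℝ d → ℝ) : Prop :=
  IsUnitBallMollifier φ ∧ ∀ x y : EuclideanSpace ℝ d, ‖x‖ = ‖y‖ → φ x = φ y

/-- A radial unit-ball mollifier is a unit-ball mollifier. [folklore] -/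
theorem IsRadialUnitBallMollifier.isUnitBallMollifier {φ : EuclideanSpace ℝ d → ℝ}
    (h : IsRadialUnitBallMollifier φ) : IsUnitBallMollifier φ :=
  h.1

/-- The plateau mollifiers are radial unit-ball mollifiers (`d` nonempty, `m > 1`). [folklore] -/
theorem isRadialUnitBallMollifier_plateauMollifier [Nonempty d] {m : ℝ} (hm : 1 < m) :
    IsRadialUnitBallMollifier (plateauMollifier d m) :=
  ⟨isUnitBallMollifier_plateauMollifier hm, fun _ _ h => plateauMollifier_radial m h⟩

variable {T : ℝ} {u : ℝ → UnitAddTorus d → EuclideanSpace ℝ d} {D : STFunctional d}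

/-- **Uniform Eyink defect.** `D` is the limit of *both* of Eyink's mollified fluxes of `u` on
`(0,T) × T^d`, *uniformly in the mollifier*: for every test function `ψ` supported in `(0,T)`,
`∫₀ᵀ∫ D_L^{ε,φ}(u) ψ → D ψ` and `∫₀ᵀ∫ D_T^{ε,φ}(u) ψ → D ψ` as `ε → 0⁺`, uniformly over all
spherically symmetric mollifiers `φ` supported in the unit ball (`IsRadialUnitBallMollifier`), in the
sense of `TendstoUniformlyOn`. This is the mode of convergence that Eyink's proof of his Thm. 1
(Eyink 2003, §2: the identities (uuL-eq), (uuT-eq) and the bounds (norm-uL-thirdu),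
(norm-pT-twothirdp), which control the rate by the `L³`/`L^{3/2}` translation moduli of `u`, `p`
and the support radius of `φ` only) yields for `L³` weak Euler solutions, and it is exactly what
upgrades the mollified limits to the shell limits of the 4/5 and 8/15 laws
(`HasUniformEyinkDefect.hasFourFifthsLaw`, `HasUniformEyinkDefect.tendsto_mixedFlux`).
A *predicate* on the data `(T, u, D)` (explicit binders, like `Torus.HasDuchonRobertDefect`):
it has inhabitants (`hasUniformEyinkDefect_zero`) and non-inhabitants
(`not_hasUniformEyinkDefect_zero_const`), and the defect `D` is determined by `u` on test
functions (`HasUniformEyinkDefect.unique`); it is a notion, not a closed named fact, and carries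
no `_holds`. [folklore] -/
def HasUniformEyinkDefect (T : ℝ) (u : ℝ → UnitAddTorus d → EuclideanSpace ℝ d)
    (D : STFunctional d) : Prop :=
  ∀ ψ : ℝ → UnitAddTorus d → ℝ, FunctionSpaces.Torus.IsSpaceTimeTestIoo T ψ →
    TendstoUniformlyOn
        (fun (ε : ℝ) (φ : EuclideanSpace ℝ d → ℝ) =>
          ∫ t in Ioo 0 T, ∫ x, eyinkLongitudinalApprox φ ε (u t) x * ψ t x)
        (fun _ => D ψ) (𝓝[>] 0) {φ | IsRadialUnitBallMollifier φ} ∧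
      TendstoUniformlyOn
        (fun (ε : ℝ) (φ : EuclideanSpace ℝ d → ℝ) =>
          ∫ t in Ioo 0 T, ∫ x, eyinkTransverseApprox φ ε (u t) x * ψ t x)
        (fun _ => D ψ) (𝓝[>] 0) {φ | IsRadialUnitBallMollifier φ}

/-- Metric form of the uniform Eyink defect property, with one `ε₀` serving both approximants:
for every `η > 0` there is `ε₀ > 0` with `|∫₀ᵀ∫ D_L^{ε,φ} ψ − D ψ| < η` and
`|∫₀ᵀ∫ D_T^{ε,φ} ψ − D ψ| < η` for all radial unit-ball mollifiers `φ` and all `ε ∈ (0, ε₀)`. [folklore] -/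
theorem HasUniformEyinkDefect.exists_forall_abs_sub_lt (h : HasUniformEyinkDefect T u D)
    {ψ : ℝ → UnitAddTorus d → ℝ} (hψ : FunctionSpaces.Torus.IsSpaceTimeTestIoo T ψ) {η : ℝ}
    (hη : 0 < η) :
    ∃ ε₀ > 0, ∀ φ, IsRadialUnitBallMollifier φ → ∀ ε ∈ Ioo 0 ε₀,
      |(∫ t in Ioo 0 T, ∫ x, eyinkLongitudinalApprox φ ε (u t) x * ψ t x) - D ψ| < η ∧
        |(∫ t in Ioo 0 T, ∫ x, eyinkTransverseApprox φ ε (u t) x * ψ t x) - D ψ| < η := by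
  have h1 := (Metric.tendstoUniformlyOn_iff.1 (h ψ hψ).1) η hη
  have h2 := (Metric.tendstoUniformlyOn_iff.1 (h ψ hψ).2) η hη
  obtain ⟨ε₀, hε₀, hsub⟩ := mem_nhdsGT_iff_exists_Ioo_subset.1 (h1.and h2)
  refine ⟨ε₀, hε₀, fun φ hφ ε hε => ?_⟩
  have := hsub hε
  refine ⟨?_, ?_⟩
  · have h' := this.1 φ hφ
    rwa [Real.dist_eq, abs_sub_comm] at h'
  · have h' := this.2 φ hφ
    rwa [Real.dist_eq, abs_sub_comm] at h'

/-- Conversely, the metric form implies the uniform Eyink defect property. [folklore] -/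
theorem hasUniformEyinkDefect_of_forall_exists
    (h : ∀ ψ : ℝ → UnitAddTorus d → ℝ, FunctionSpaces.Torus.IsSpaceTimeTestIoo T ψ → ∀ η > 0,
      ∃ ε₀ > 0, ∀ φ, IsRadialUnitBallMollifier φ → ∀ ε ∈ Ioo 0 ε₀,
        |(∫ t in Ioo 0 T, ∫ x, eyinkLongitudinalApprox φ ε (u t) x * ψ t x) - D ψ| < η ∧
          |(∫ t in Ioo 0 T, ∫ x, eyinkTransverseApprox φ ε (u t) x * ψ t x) - D ψ| < η) :
    HasUniformEyinkDefect T u D := by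
  intro ψ hψ
  refine ⟨Metric.tendstoUniformlyOn_iff.2 fun η hη => ?_, Metric.tendstoUniformlyOn_iff.2 fun η hη => ?_⟩
  · obtain ⟨ε₀, hε₀, hb⟩ := h ψ hψ η hη
    filter_upwards [Ioo_mem_nhdsGT hε₀] with ε hε φ hφ
    rw [Real.dist_eq, abs_sub_comm]
    exact (hb φ hφ ε hε).1
  · obtain ⟨ε₀, hε₀, hb⟩ := h ψ hψ η hη
    filter_upwards [Ioo_mem_nhdsGT hε₀] with ε hε φ hφ
    rw [Real.dist_eq, abs_sub_comm]
    exact (hb φ hφ ε hε).2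

/-- **A uniform Eyink defect gives Eyink's Theorem 1 for every radial unit-ball mollifier**: for
such `φ`, `∫₀ᵀ∫ D_L^{ε,φ}(u) ψ → D ψ` and `∫₀ᵀ∫ D_T^{ε,φ}(u) ψ → D ψ` (uniform ⇒ pointwise). [folklore] -/
theorem HasUniformEyinkDefect.tendsto (h : HasUniformEyinkDefect T u D)
    {φ : EuclideanSpace ℝ d → ℝ} (hφ : IsRadialUnitBallMollifier φ)
    {ψ : ℝ → UnitAddTorus d → ℝ} (hψ : FunctionSpaces.Torus.IsSpaceTimeTestIoo T ψ) :
    Tendsto (fun ε => ∫ t in Ioo 0 T, ∫ x, eyinkLongitudinalApprox φ ε (u t) x * ψ t x)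
        (𝓝[>] 0) (𝓝 (D ψ)) ∧
      Tendsto (fun ε => ∫ t in Ioo 0 T, ∫ x, eyinkTransverseApprox φ ε (u t) x * ψ t x)
        (𝓝[>] 0) (𝓝 (D ψ)) :=
  ⟨((h ψ hψ).1.tendsto_at hφ), ((h ψ hψ).2.tendsto_at hφ)⟩

end Uniform

/-! ## Cubic shell pairings and their continuity in the scale -/

section CubicShell

variable {T : ℝ} {u : ℝ → UnitAddTorus d → EuclideanSpace ℝ d} {ψ : ℝ → UnitAddTorus d → ℝ}
  {Q : EuclideanSpace ℝ d → EuclideanSpace ℝ d → ℝ} {CQ CL Cψ : ℝ}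

/-- The **shell pairing of a cubic form** `Q`:
`I_Q(r) = ∫_{(0,T) × T^d} ⨍_{S^{d-1}} Q(ω, δu(t,x; rω)) dω ψ(t,x)` (product-measure form), generalising
`Torus.energyFluxShellPairing` (`Q(ω,v) = ⟪v,ω⟫|v|²`) to the longitudinal form `⟪v,ω⟫³` (inside Eyink's
`S_L`) and the mixed form `⟪v,ω⟫|v − ⟪v,ω⟫ω|²` (inside `S_T`). [folklore] -/
def cubicShellPairing (Q : EuclideanSpace ℝ d → EuclideanSpace ℝ d → ℝ) (T : ℝ)
    (u : ℝ → UnitAddTorus d → EuclideanSpace ℝ d) (ψ : ℝ → UnitAddTorus d → ℝ) (r : ℝ) : ℝ :=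
  ∫ p, sphereAvg (fun y => Q y (increment (u p.1) (r • y) p.2)) * ψ p.1 p.2
    ∂((volume.restrict (Ioo 0 T)).prod volume)

/-- Unfolding `cubicShellPairing`. [folklore] -/
theorem cubicShellPairing_apply (r : ℝ) :
    cubicShellPairing Q T u ψ r =
      ∫ p, sphereAvg (fun y => Q y (increment (u p.1) (r • y) p.2)) * ψ p.1 p.2
        ∂((volume.restrict (Ioo 0 T)).prod volume) :=
  rfl

/-- The longitudinal cubic form `Q_L(ω,v) = ⟪v,ω⟫³` is Lipschitz on bounded sets, cubically:
`|⟪v,ω⟫³ − ⟪w,ω⟫³| ≤ |v − w| (|v| + |w|)²` for `|ω| ≤ 1`. [folklore] -/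
theorem abs_cubicFormL_sub_le {E : Type*} [NormedAddCommGroup E] [InnerProductSpace ℝ E]
    (ω v w : E) (hω : ‖ω‖ ≤ 1) :
    |⟪v, ω⟫ ^ 3 - ⟪w, ω⟫ ^ 3| ≤ 1 * (‖v - w‖ * (‖v‖ + ‖w‖) ^ 2) := by
  set a : ℝ := ⟪v, ω⟫ with ha
  set b : ℝ := ⟪w, ω⟫ with hb
  have hab : |a - b| ≤ ‖v - w‖ := by
    rw [ha, hb, ← inner_sub_left]
    calc |⟪v - w, ω⟫| ≤ ‖v - w‖ * ‖ω‖ := abs_real_inner_le_norm _ _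
      _ ≤ ‖v - w‖ * 1 := by gcongr
      _ = ‖v - w‖ := mul_one _
  have hav : |a| ≤ ‖v‖ := by
    calc |a| ≤ ‖v‖ * ‖ω‖ := abs_real_inner_le_norm _ _
      _ ≤ ‖v‖ * 1 := by gcongr
      _ = ‖v‖ := mul_one _
  have hbw : |b| ≤ ‖w‖ := by
    calc |b| ≤ ‖w‖ * ‖ω‖ := abs_real_inner_le_norm _ _
      _ ≤ ‖w‖ * 1 := by gcongr
      _ = ‖w‖ := mul_one _
  have hfac : a ^ 3 - b ^ 3 = (a - b) * (a ^ 2 + a * b + b ^ 2) := by ring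
  rw [one_mul, hfac, abs_mul]
  have h2 : |a ^ 2 + a * b + b ^ 2| ≤ (‖v‖ + ‖w‖) ^ 2 := by
    calc |a ^ 2 + a * b + b ^ 2| ≤ |a ^ 2| + |a * b| + |b ^ 2| := by
          calc |a ^ 2 + a * b + b ^ 2| ≤ |a ^ 2 + a * b| + |b ^ 2| := abs_add_le _ _
            _ ≤ |a ^ 2| + |a * b| + |b ^ 2| := by gcongr; exact abs_add_le _ _
      _ = |a| ^ 2 + |a| * |b| + |b| ^ 2 := by rw [abs_pow, abs_mul, abs_pow]
      _ ≤ ‖v‖ ^ 2 + ‖v‖ * ‖w‖ + ‖w‖ ^ 2 := by gcongr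
      _ ≤ (‖v‖ + ‖w‖) ^ 2 := by nlinarith [norm_nonneg v, norm_nonneg w]
  exact mul_le_mul hab h2 (abs_nonneg _) (norm_nonneg _)

/-- Expansion of the mixed cubic form: `⟪v,ω⟫|v − ⟪v,ω⟫ω|² = ⟪v,ω⟫|v|² − (2 − |ω|²)⟪v,ω⟫³`. [folklore] -/
theorem cubicFormT_eq {E : Type*} [NormedAddCommGroup E] [InnerProductSpace ℝ E] (ω v : E) :
    ⟪v, ω⟫ * ‖v - ⟪v, ω⟫ • ω‖ ^ 2 = ⟪v, ω⟫ * ‖v‖ ^ 2 - (2 - ‖ω‖ ^ 2) * ⟪v, ω⟫ ^ 3 := by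
  have h : ‖v - ⟪v, ω⟫ • ω‖ ^ 2 = ‖v‖ ^ 2 - 2 * ⟪v, ω⟫ ^ 2 + ⟪v, ω⟫ ^ 2 * ‖ω‖ ^ 2 := by
    rw [norm_sub_sq_real, inner_smul_right, norm_smul, Real.norm_eq_abs, mul_pow, sq_abs]
    ring
  rw [h]
  ring

/-- The mixed cubic form `Q_T(ω,v) = ⟪v,ω⟫|v − ⟪v,ω⟫ω|²` is Lipschitz on bounded sets, cubically:
`|Q_T(ω,v) − Q_T(ω,w)| ≤ 3 |v − w| (|v| + |w|)²` for `|ω| ≤ 1`. [folklore] -/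
theorem abs_cubicFormT_sub_le {E : Type*} [NormedAddCommGroup E] [InnerProductSpace ℝ E]
    (ω v w : E) (hω : ‖ω‖ ≤ 1) :
    |⟪v, ω⟫ * ‖v - ⟪v, ω⟫ • ω‖ ^ 2 - ⟪w, ω⟫ * ‖w - ⟪w, ω⟫ • ω‖ ^ 2| ≤
      3 * (‖v - w‖ * (‖v‖ + ‖w‖) ^ 2) := by
  rw [cubicFormT_eq, cubicFormT_eq]
  have hI := abs_inner_mul_norm_sq_sub_le ω v w hω
  have hL := abs_cubicFormL_sub_le ω v w hω
  rw [one_mul] at hL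
  have hω2 : |2 - ‖ω‖ ^ 2| ≤ 2 := by
    rw [abs_of_nonneg (by nlinarith [norm_nonneg ω])]
    nlinarith [norm_nonneg ω]
  have hsplit : ⟪v, ω⟫ * ‖v‖ ^ 2 - (2 - ‖ω‖ ^ 2) * ⟪v, ω⟫ ^ 3 -
      (⟪w, ω⟫ * ‖w‖ ^ 2 - (2 - ‖ω‖ ^ 2) * ⟪w, ω⟫ ^ 3) =
      (⟪v, ω⟫ * ‖v‖ ^ 2 - ⟪w, ω⟫ * ‖w‖ ^ 2) - (2 - ‖ω‖ ^ 2) * (⟪v, ω⟫ ^ 3 - ⟪w, ω⟫ ^ 3) := by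
    ring
  rw [hsplit]
  calc |⟪v, ω⟫ * ‖v‖ ^ 2 - ⟪w, ω⟫ * ‖w‖ ^ 2 - (2 - ‖ω‖ ^ 2) * (⟪v, ω⟫ ^ 3 - ⟪w, ω⟫ ^ 3)|
      ≤ |⟪v, ω⟫ * ‖v‖ ^ 2 - ⟪w, ω⟫ * ‖w‖ ^ 2| + |(2 - ‖ω‖ ^ 2) * (⟪v, ω⟫ ^ 3 - ⟪w, ω⟫ ^ 3)| :=
        abs_sub _ _
    _ = |⟪v, ω⟫ * ‖v‖ ^ 2 - ⟪w, ω⟫ * ‖w‖ ^ 2| + |2 - ‖ω‖ ^ 2| * |⟪v, ω⟫ ^ 3 - ⟪w, ω⟫ ^ 3| := by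
        rw [abs_mul]
    _ ≤ ‖v - w‖ * (‖v‖ + ‖w‖) ^ 2 + 2 * (‖v - w‖ * (‖v‖ + ‖w‖) ^ 2) := by
        gcongr
    _ = 3 * (‖v - w‖ * (‖v‖ + ‖w‖) ^ 2) := by ring

/-- **Continuity of cubic shell pairings in the scale** for `u ∈ L³((0,T) × T^d)` and bounded
measurable `ψ`: if `Q` is continuous, `|Q(ω,v)| ≤ C_Q|v|³` and
`|Q(ω,v) − Q(ω,w)| ≤ C_L |v − w|(|v| + |w|)²` for `|ω| ≤ 1`, then `r ↦ I_Q(r)` is continuous on `ℝ`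
(continuity of translation in `L³` along sphere shears, `tendsto_eLpNorm_comp_sphereShear_sub`, and
Hölder `3, 3/2`, `lintegral_mul_add_sq_le`; the proof of `continuous_shellPairing` verbatim for a
general cubic form). [folklore] -/
theorem continuous_cubicShellPairing [Nonempty d]
    (hu : AEStronglyMeasurable (uncurry u) ((volume.restrict (Ioo 0 T)).prod volume))
    (hu3 : ∫⁻ p, ‖uncurry u p‖ₑ ^ 3 ∂((volume.restrict (Ioo 0 T)).prod volume) < ∞)
    (hψm : AEStronglyMeasurable (uncurry ψ) ((volume.restrict (Ioo 0 T)).prod volume))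
    (hψb : ∀ t x, |ψ t x| ≤ Cψ)
    (hQc : Continuous (uncurry Q)) (hCQ : 0 ≤ CQ) (hQ : ∀ ω v, ‖ω‖ ≤ 1 → |Q ω v| ≤ CQ * ‖v‖ ^ 3)
    (hCL : 0 ≤ CL)
    (hQL : ∀ ω v w, ‖ω‖ ≤ 1 → |Q ω v - Q ω w| ≤ CL * (‖v - w‖ * (‖v‖ + ‖w‖) ^ 2)) :
    Continuous (cubicShellPairing Q T u ψ) := by
  set μp : Measure (ℝ × UnitAddTorus d) := (volume.restrict (Ioo 0 T)).prod volume with hμp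
  set σ : Measure ↥(sphere (0 : EuclideanSpace ℝ d) 1) := volume.toSphere with hσ
  set ν := μp.prod σ with hν
  have hCψ : 0 ≤ Cψ := (abs_nonneg _).trans (hψb 0 0)
  set c : ℝ := (volume : Measure (EuclideanSpace ℝ d)).toSphere.real univ with hcdef
  have hc : 0 < c := toSphere_real_univ_pos
  -- the integrand on `((0,T) × T^d) × S^{d-1}` and its integrability
  set W : ℝ → (ℝ × UnitAddTorus d) × ↥(sphere (0 : EuclideanSpace ℝ d) 1) → ℝ := fun r y =>
    Q y.2 (increment (u y.1.1) (r • (y.2 : EuclideanSpace ℝ d)) y.1.2) * ψ y.1.1 y.1.2 with hW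
  have hWi : ∀ r, Integrable (W r) ν := fun r =>
    integrable_sphere_increment hu hu3 hψm hψb hQc hCQ hQ r
  -- the shell pairing is `c⁻¹ ∫ W r`
  have hid : ∀ r, cubicShellPairing Q T u ψ r = c⁻¹ * ∫ y, W r y ∂ν := by
    intro r
    rw [cubicShellPairing, ← hμp, integral_prod _ (hWi r)]
    have h4 : ∀ p : ℝ × UnitAddTorus d,
        ∫ ω : sphere (0 : EuclideanSpace ℝ d) 1,
            Q ω (increment (u p.1) (r • (ω : EuclideanSpace ℝ d)) p.2) * ψ p.1 p.2 ∂σ =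
          c * (sphereAvg (fun y => Q y (increment (u p.1) (r • y) p.2)) * ψ p.1 p.2) := fun p => by
      rw [integral_mul_const,
        integral_sphere_eq_mul_sphereAvg (fun y => Q y (increment (u p.1) (r • y) p.2)), mul_assoc]
    rw [integral_congr_ae (ae_of_all _ h4), integral_const_mul, ← mul_assoc, inv_mul_cancel₀ hc.ne',
      one_mul]
  -- reduce to continuity of `r ↦ ∫ W r` in `L¹`
  suffices hcont : ∀ r₀, Tendsto (fun r => ∫ y, W r y ∂ν) (𝓝 r₀) (𝓝 (∫ y, W r₀ y ∂ν)) by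
    have heq : cubicShellPairing Q T u ψ = fun r => c⁻¹ * ∫ y, W r y ∂ν := funext hid
    rw [heq]
    exact continuous_iff_continuousAt.2 fun r₀ => (hcont r₀).const_mul c⁻¹
  intro r₀
  refine tendsto_integral_of_L1 (W r₀) (hWi r₀).aestronglyMeasurable (Eventually.of_forall hWi) ?_
  -- the unshifted field on the triple product and its cube integrability
  set U : (ℝ × UnitAddTorus d) × ↥(sphere (0 : EuclideanSpace ℝ d) 1) → EuclideanSpace ℝ d :=
    fun y => u y.1.1 y.1.2 with hUdef
  have hUm : AEStronglyMeasurable U ν := hu.comp_fst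
  set L : ℝ≥0∞ := ∫⁻ p, ‖uncurry u p‖ₑ ^ 3 ∂μp with hL
  have hshift3 : ∀ r, ∫⁻ y, ‖U (sphereShear d r y)‖ₑ ^ 3 ∂ν = σ univ * L := by
    intro r
    have ha : Measurable fun ω : sphere (0 : EuclideanSpace ℝ d) 1 =>
        FunctionSpaces.Torus.proj (r • (ω : EuclideanSpace ℝ d)) :=
      FunctionSpaces.Torus.measurable_proj.comp (continuous_subtype_val.const_smul r).measurable
    have := lintegral_mul_translate_enorm_pow (ν := σ) hu ha (w := fun _ => 1) aemeasurable_const 3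
    simp only [one_mul, lintegral_const] at this
    exact this
  have hU3 : ∫⁻ y, ‖U y‖ₑ ^ 3 ∂ν = σ univ * L := by
    have := hshift3 0
    simp only [sphereShear_apply, zero_smul, FunctionSpaces.Torus.proj_zero, add_zero] at this
    exact this
  have hσfin : σ univ < ∞ := measure_lt_top _ _
  have hLfin : σ univ * L < ∞ := ENNReal.mul_lt_top hσfin hu3
  have hUp : MemLp U 3 ν := by
    refine ⟨hUm, ?_⟩
    rw [eLpNorm_three_eq, hU3]
    exact ENNReal.rpow_lt_top_of_nonneg (by norm_num) hLfin.ne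
  -- continuity of translation
  have hT := tendsto_eLpNorm_comp_sphereShear_sub (T := T) (by norm_num) (by norm_num) hUp r₀
  -- cube bounds for the increments
  set δ : ℝ → (ℝ × UnitAddTorus d) × ↥(sphere (0 : EuclideanSpace ℝ d) 1) → EuclideanSpace ℝ d :=
    fun r y => increment (u y.1.1) (r • (y.2 : EuclideanSpace ℝ d)) y.1.2 with hδdef
  have hδeq : ∀ r y, δ r y = U (sphereShear d r y) - U y := fun r y => rfl
  have hδm : ∀ r, AEStronglyMeasurable (δ r) ν := fun r => aestronglyMeasurable_increment_sphere hu r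
  have hδ3 : ∀ r, ∫⁻ y, ‖δ r y‖ₑ ^ 3 ∂ν ≤ 4 * (σ univ * L + σ univ * L) := by
    intro r
    calc ∫⁻ y, ‖δ r y‖ₑ ^ 3 ∂ν ≤ ∫⁻ y, 4 * (‖U (sphereShear d r y)‖ₑ ^ 3 + ‖U y‖ₑ ^ 3) ∂ν := by
          refine lintegral_mono fun y => ?_
          rw [hδeq]
          exact (pow_le_pow_left' (enorm_sub_le (E := EuclideanSpace ℝ d)) 3).trans (ennreal_add_pow_three_le _ _)
      _ = 4 * (σ univ * L + σ univ * L) := by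
          rw [lintegral_const_mul' _ _ (by norm_num), lintegral_add_left' ?_, hshift3 r, hU3]
          exact ((hUm.comp_measurePreserving (measurePreserving_sphereShear _ r)).enorm.pow_const 3)
  set M : ℝ≥0∞ := 4 * (4 * (σ univ * L + σ univ * L) + 4 * (σ univ * L + σ univ * L)) with hM
  have hMfin : M ≠ ∞ := by
    have h8 : 4 * (σ univ * L + σ univ * L) ≠ ∞ :=
      ENNReal.mul_ne_top (by norm_num) (ENNReal.add_ne_top.2 ⟨hLfin.ne, hLfin.ne⟩)
    exact ENNReal.mul_ne_top (by norm_num) (ENNReal.add_ne_top.2 ⟨h8, h8⟩)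
  -- pointwise bound on the difference of the integrands
  have hpt : ∀ r y, ‖W r y - W r₀ y‖ₑ ≤
      ENNReal.ofReal (CL * Cψ) *
        (‖U (sphereShear d r y) - U (sphereShear d r₀ y)‖ₑ * (‖δ r y‖ₑ + ‖δ r₀ y‖ₑ) ^ 2) := by
    intro r y
    have hω : ‖(y.2 : EuclideanSpace ℝ d)‖ ≤ 1 := (norm_eq_of_mem_sphere y.2).le
    have hreal : |W r y - W r₀ y| ≤ CL * Cψ * (‖δ r y - δ r₀ y‖ * (‖δ r y‖ + ‖δ r₀ y‖) ^ 2) := by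
      have : W r y - W r₀ y = (Q y.2 (δ r y) - Q y.2 (δ r₀ y)) * ψ y.1.1 y.1.2 := by
        simp only [hW, hδdef]; ring
      rw [this, abs_mul]
      calc |Q y.2 (δ r y) - Q y.2 (δ r₀ y)| * |ψ y.1.1 y.1.2|
          ≤ CL * (‖δ r y - δ r₀ y‖ * (‖δ r y‖ + ‖δ r₀ y‖) ^ 2) * Cψ :=
            mul_le_mul (hQL _ _ _ hω) (hψb _ _) (abs_nonneg _) (by positivity)
        _ = CL * Cψ * (‖δ r y - δ r₀ y‖ * (‖δ r y‖ + ‖δ r₀ y‖) ^ 2) := by ring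
    have hsub : δ r y - δ r₀ y = U (sphereShear d r y) - U (sphereShear d r₀ y) := by
      rw [hδeq, hδeq]; abel
    rw [Real.enorm_eq_ofReal_abs]
    refine (ENNReal.ofReal_le_ofReal hreal).trans (le_of_eq ?_)
    rw [ENNReal.ofReal_mul (mul_nonneg hCL hCψ), ENNReal.ofReal_mul (norm_nonneg _),
      ENNReal.ofReal_pow (by positivity),
      ENNReal.ofReal_add (norm_nonneg _) (norm_nonneg _), ofReal_norm, ofReal_norm,
      ofReal_norm, hsub]
  -- integrate the bound: Hölder
  have hbound : ∀ r, ∫⁻ y, ‖W r y - W r₀ y‖ₑ ∂ν ≤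
      ENNReal.ofReal (CL * Cψ) * (eLpNorm (fun y => U (sphereShear d r y) - U (sphereShear d r₀ y)) 3 ν *
        M ^ (2 / 3 : ℝ)) := by
    intro r
    have hfm : AEMeasurable (fun y => ‖U (sphereShear d r y) - U (sphereShear d r₀ y)‖ₑ) ν :=
      ((hUm.comp_measurePreserving (measurePreserving_sphereShear _ r)).sub
        (hUm.comp_measurePreserving (measurePreserving_sphereShear _ r₀))).enorm
    calc ∫⁻ y, ‖W r y - W r₀ y‖ₑ ∂ν
        ≤ ∫⁻ y, ENNReal.ofReal (CL * Cψ) * (‖U (sphereShear d r y) - U (sphereShear d r₀ y)‖ₑ *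
            (‖δ r y‖ₑ + ‖δ r₀ y‖ₑ) ^ 2) ∂ν := lintegral_mono (hpt r)
      _ = ENNReal.ofReal (CL * Cψ) * ∫⁻ y, ‖U (sphereShear d r y) - U (sphereShear d r₀ y)‖ₑ *
            (‖δ r y‖ₑ + ‖δ r₀ y‖ₑ) ^ 2 ∂ν := lintegral_const_mul' _ _ ENNReal.ofReal_ne_top
      _ ≤ ENNReal.ofReal (CL * Cψ) *
            ((∫⁻ y, ‖U (sphereShear d r y) - U (sphereShear d r₀ y)‖ₑ ^ 3 ∂ν) ^ (1 / 3 : ℝ) *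
            (4 * (∫⁻ y, ‖δ r y‖ₑ ^ 3 ∂ν + ∫⁻ y, ‖δ r₀ y‖ₑ ^ 3 ∂ν)) ^ (2 / 3 : ℝ)) := by
          gcongr
          exact lintegral_mul_add_sq_le ν hfm (hδm r).enorm (hδm r₀).enorm
      _ ≤ ENNReal.ofReal (CL * Cψ) *
            (eLpNorm (fun y => U (sphereShear d r y) - U (sphereShear d r₀ y)) 3 ν *
            M ^ (2 / 3 : ℝ)) := by
          rw [eLpNorm_three_eq]
          gcongr ENNReal.ofReal (CL * Cψ) * (_ * ?_ ^ (2 / 3 : ℝ))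
          rw [hM]
          gcongr
          · exact hδ3 r
          · exact hδ3 r₀
  -- squeeze
  have hlim : Tendsto (fun r => ENNReal.ofReal (CL * Cψ) *
      (eLpNorm (fun y => U (sphereShear d r y) - U (sphereShear d r₀ y)) 3 ν * M ^ (2 / 3 : ℝ)))
      (𝓝 r₀) (𝓝 0) := by
    have h1 := ENNReal.Tendsto.mul_const hT
      (Or.inr (ENNReal.rpow_ne_top_of_nonneg (y := (2 / 3 : ℝ)) (by norm_num) hMfin))
    rw [zero_mul] at h1
    have h2 := ENNReal.Tendsto.const_mul h1 (Or.inr ENNReal.ofReal_ne_top) (a := ENNReal.ofReal (CL * Cψ))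
    rwa [mul_zero] at h2
  exact tendsto_of_tendsto_of_tendsto_of_le_of_le tendsto_const_nhds hlim (fun r => bot_le) hbound

/-- Continuity in the scale of the **longitudinal** shell pairing
`r ↦ ∫∫ ⨍ (δu(rω)·ω)³ dω ψ`. [folklore] -/
theorem continuous_cubicShellPairing_L [Nonempty d]
    (hu : AEStronglyMeasurable (uncurry u) ((volume.restrict (Ioo 0 T)).prod volume))
    (hu3 : ∫⁻ p, ‖uncurry u p‖ₑ ^ 3 ∂((volume.restrict (Ioo 0 T)).prod volume) < ∞)
    (hψm : AEStronglyMeasurable (uncurry ψ) ((volume.restrict (Ioo 0 T)).prod volume))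
    (hψb : ∀ t x, |ψ t x| ≤ Cψ) :
    Continuous (cubicShellPairing (fun (ω v : EuclideanSpace ℝ d) => ⟪v, ω⟫ ^ 3) T u ψ) :=
  continuous_cubicShellPairing hu hu3 hψm hψb continuous_cubicFormL zero_le_one
    (fun _ v hω => abs_cubicFormL_le v hω) zero_le_one (fun ω v w hω => abs_cubicFormL_sub_le ω v w hω)

/-- Continuity in the scale of the **mixed** shell pairing
`r ↦ ∫∫ ⨍ (δu(rω)·ω) |δu(rω) − (δu(rω)·ω)ω|² dω ψ`. [folklore] -/
theorem continuous_cubicShellPairing_T [Nonempty d]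
    (hu : AEStronglyMeasurable (uncurry u) ((volume.restrict (Ioo 0 T)).prod volume))
    (hu3 : ∫⁻ p, ‖uncurry u p‖ₑ ^ 3 ∂((volume.restrict (Ioo 0 T)).prod volume) < ∞)
    (hψm : AEStronglyMeasurable (uncurry ψ) ((volume.restrict (Ioo 0 T)).prod volume))
    (hψb : ∀ t x, |ψ t x| ≤ Cψ) :
    Continuous (cubicShellPairing
      (fun (ω v : EuclideanSpace ℝ d) => ⟪v, ω⟫ * ‖v - ⟪v, ω⟫ • ω‖ ^ 2) T u ψ) :=
  continuous_cubicShellPairing hu hu3 hψm hψb continuous_cubicFormT (by norm_num)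
    (fun _ v hω => abs_cubicFormT_le v hω) (by norm_num) (fun ω v w hω => abs_cubicFormT_sub_le ω v w hω)

end CubicShell

/-! ## Plateau profiles against integrable functions: the second un-averaging lemma -/

section PlateauLimit

/-- **The plateau bumps fill the unit ball**: `∫ ρ_m → vol(B₁)` as `m → ∞` (`m = k + 2`), by
dominated convergence (`ρ_m ↑ 𝟙_{B₁}` pointwise on `ℝ^d`, `0 ≤ ρ_m ≤ 𝟙_{B̄₁}`). [folklore] -/
theorem tendsto_integral_plateauBump :
    Tendsto (fun k : ℕ => ∫ ξ : EuclideanSpace ℝ d, plateauBump ((k : ℝ) + 2) ξ) atTop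
      (𝓝 ((volume : Measure (EuclideanSpace ℝ d)).real (ball 0 1))) := by
  have hm : ∀ k : ℕ, (1 : ℝ) < (k : ℝ) + 2 := fun k => by
    have : (0 : ℝ) ≤ k := Nat.cast_nonneg k
    linarith
  have hlim_eq : (volume : Measure (EuclideanSpace ℝ d)).real (ball 0 1) =
      ∫ ξ : EuclideanSpace ℝ d, (ball (0 : EuclideanSpace ℝ d) 1).indicator (fun _ => (1 : ℝ)) ξ := by
    rw [integral_indicator measurableSet_ball, setIntegral_const, smul_eq_mul, mul_one]
  rw [hlim_eq]
  refine tendsto_integral_of_dominated_convergence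
    (fun ξ => (closedBall (0 : EuclideanSpace ℝ d) 1).indicator (fun _ => (1 : ℝ)) ξ)
    (fun k => (continuous_plateauBump (hm k)).aestronglyMeasurable) ?_ ?_ ?_
  · exact (integrable_indicator_iff measurableSet_closedBall).2
      (integrableOn_const (measure_closedBall_lt_top.ne))
  · intro k
    refine ae_of_all _ fun ξ => ?_
    rw [Real.norm_eq_abs, abs_of_nonneg (plateauBump_nonneg _ _)]
    by_cases hξ : ξ ∈ closedBall (0 : EuclideanSpace ℝ d) 1
    · rw [indicator_of_mem hξ]
      exact plateauBump_le_one _ _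
    · rw [indicator_of_notMem hξ]
      have h1 : 1 ≤ ‖ξ‖ := by
        rw [mem_closedBall, dist_zero_right, not_le] at hξ
        exact hξ.le
      rw [plateauBump_eq_zero (zero_le_one.trans (hm k).le) h1]
  · refine ae_of_all _ fun ξ => ?_
    by_cases hξ : ξ ∈ ball (0 : EuclideanSpace ℝ d) 1
    · rw [indicator_of_mem hξ]
      have hξ' : ‖ξ‖ < 1 := by simpa [dist_zero_right] using hξ
      -- eventually `ρ_m ξ = 1`
      refine tendsto_const_nhds.congr' ?_
      obtain ⟨N, hN⟩ := exists_nat_gt (1 - ‖ξ‖)⁻¹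
      filter_upwards [eventually_ge_atTop N] with k hk
      have hk' : (1 - ‖ξ‖)⁻¹ ≤ (k : ℝ) + 2 := by
        have : (N : ℝ) ≤ k := by exact_mod_cast hk
        linarith
      have hpos : 0 < 1 - ‖ξ‖ := by linarith
      refine (plateauBump_eq_one (by linarith [hm k]) ?_).symm
      have hinv : ((k : ℝ) + 2)⁻¹ ≤ 1 - ‖ξ‖ := by
        have := inv_anti₀ (inv_pos.2 hpos) hk'
        rwa [inv_inv] at this
      linarith
    · rw [indicator_of_notMem hξ]
      have h1 : 1 ≤ ‖ξ‖ := by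
        rw [mem_ball, dist_zero_right, not_lt] at hξ
        exact hξ
      refine tendsto_const_nhds.congr' (Eventually.of_forall fun k => ?_)
      exact (plateauBump_eq_zero (zero_le_one.trans (hm k).le) h1).symm

/-- The normalising constants of the plateau mollifiers converge: `(∫ ρ_m)⁻¹ → vol(B₁)⁻¹ = d/|S^{d-1}|`
(`Measure.toSphere_real_apply_univ`: `|S^{d-1}| = d · vol(B₁)`). [folklore] -/
theorem tendsto_inv_integral_plateauBump [Nonempty d] :
    Tendsto (fun k : ℕ => (∫ ξ : EuclideanSpace ℝ d, plateauBump ((k : ℝ) + 2) ξ)⁻¹) atTop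
      (𝓝 ((Fintype.card d : ℝ) / (volume : Measure (EuclideanSpace ℝ d)).toSphere.real univ)) := by
  have hball : 0 < (volume : Measure (EuclideanSpace ℝ d)).real (ball 0 1) :=
    ENNReal.toReal_pos (measure_ball_pos volume _ one_pos).ne' measure_ball_lt_top.ne
  have hc : (volume : Measure (EuclideanSpace ℝ d)).toSphere.real univ =
      (Fintype.card d : ℝ) * (volume : Measure (EuclideanSpace ℝ d)).real (ball 0 1) := by
    rw [Measure.toSphere_real_apply_univ, finrank_euclideanSpace]
  have hn : (0 : ℝ) < Fintype.card d := by exact_mod_cast Fintype.card_pos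
  have heq : (Fintype.card d : ℝ) / (volume : Measure (EuclideanSpace ℝ d)).toSphere.real univ =
      ((volume : Measure (EuclideanSpace ℝ d)).real (ball 0 1))⁻¹ := by
    rw [hc]
    field_simp
  rw [heq]
  exact (tendsto_integral_plateauBump (d := d)).inv₀ hball.ne'

/-- **Second un-averaging lemma.** For `H` integrable on `(0,1]`, the pairings of `H` with the
profiles `Φ_m(x) = φ_m(x e₀)` of the plateau mollifiers (`m = k + 2`) over `(0,∞)` converge to
`(d/|S^{d-1}|) ∫_{(0,1]} H` as `k → ∞`: `Φ_m = a_m S(m(1 − x))` on `x > 0` with `a_m → d/|S^{d-1}|`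
(`tendsto_inv_integral_plateauBump`), `0 ≤ S ≤ 1`, `S(m(1−x)) → 1` for `x < 1`, and `Φ_m = 0` for
`x > 1` (dominated convergence). [folklore] -/
theorem tendsto_integral_plateauMollifier_profile_mul [Nonempty d] {e₀ : EuclideanSpace ℝ d}
    (he₀ : ‖e₀‖ = 1) {H : ℝ → ℝ} (hH : IntegrableOn H (Ioc 0 1)) :
    Tendsto (fun k : ℕ => ∫ x in Ioi (0 : ℝ), plateauMollifier d ((k : ℝ) + 2) (x • e₀) * H x) atTop
      (𝓝 ((Fintype.card d : ℝ) / (volume : Measure (EuclideanSpace ℝ d)).toSphere.real univ *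
        ∫ x in Ioc (0 : ℝ) 1, H x)) := by
  have hm : ∀ k : ℕ, (1 : ℝ) < (k : ℝ) + 2 := fun k => by
    have : (0 : ℝ) ≤ k := Nat.cast_nonneg k
    linarith
  have hm0 : ∀ k : ℕ, (0 : ℝ) ≤ (k : ℝ) + 2 := fun k => zero_le_one.trans (hm k).le
  set a : ℕ → ℝ := fun k => (∫ η : EuclideanSpace ℝ d, plateauBump ((k : ℝ) + 2) η)⁻¹ with ha
  -- restrict to `(0,1]` and factor out `a_k`
  have hId : ∀ k : ℕ, ∫ x in Ioi (0 : ℝ), plateauMollifier d ((k : ℝ) + 2) (x • e₀) * H x =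
      a k * ∫ x in Ioc (0 : ℝ) 1, Real.smoothTransition (((k : ℝ) + 2) * (1 - x)) * H x := by
    intro k
    rw [setIntegral_eq_of_subset_of_forall_sdiff_eq_zero measurableSet_Ioi Ioc_subset_Ioi_self
      fun x hx => ?_, ← integral_const_mul]
    · refine setIntegral_congr_fun measurableSet_Ioc fun x hx => ?_
      rw [plateauMollifier_smul_of_pos he₀ hx.1, mul_assoc]
    · have hx1 : 1 < x := by
        have h1 : x ∈ Ioi (0 : ℝ) := hx.1
        have h2 : x ∉ Ioc (0 : ℝ) 1 := hx.2
        by_contra h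
        exact h2 ⟨h1, not_lt.1 h⟩
      rw [plateauMollifier_profile_eq_zero (hm0 k) he₀ hx1, zero_mul]
  simp_rw [hId]
  refine (tendsto_inv_integral_plateauBump (d := d)).mul ?_
  -- dominated convergence on `(0,1]`
  refine tendsto_integral_of_dominated_convergence (fun x => ‖H x‖) (fun k => ?_) hH.norm ?_ ?_
  · refine AEStronglyMeasurable.mul ?_ hH.aestronglyMeasurable
    exact (Real.smoothTransition.continuous.comp
      (continuous_const.mul (continuous_const.sub continuous_id))).aestronglyMeasurable
  · intro k
    refine ae_of_all _ fun x => ?_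
    rw [norm_mul, Real.norm_eq_abs, abs_of_nonneg (Real.smoothTransition.nonneg _)]
    calc Real.smoothTransition (((k : ℝ) + 2) * (1 - x)) * ‖H x‖ ≤ 1 * ‖H x‖ := by
          gcongr; exact Real.smoothTransition.le_one _
      _ = ‖H x‖ := one_mul _
  · -- pointwise: on `(0,1)` (a.e. on `(0,1]`) the transition factor is eventually `1`
    have hae : ∀ᵐ x ∂(volume.restrict (Ioc (0 : ℝ) 1)), x < 1 := by
      rw [ae_restrict_iff' measurableSet_Ioc]
      have : ∀ᵐ x ∂(volume : Measure ℝ), x ≠ 1 := ae_ne volume 1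
      filter_upwards [this] with x hx hxI
      exact lt_of_le_of_ne hxI.2 hx
    filter_upwards [hae] with x hx
    refine tendsto_const_nhds.congr' ?_
    obtain ⟨N, hN⟩ := exists_nat_gt (1 - x)⁻¹
    filter_upwards [eventually_ge_atTop N] with k hk
    have hpos : 0 < 1 - x := by linarith
    have hk' : (1 - x)⁻¹ ≤ (k : ℝ) + 2 := by
      have : (N : ℝ) ≤ k := by exact_mod_cast hk
      linarith
    have h1 : 1 ≤ ((k : ℝ) + 2) * (1 - x) := by
      calc (1 : ℝ) = (1 - x)⁻¹ * (1 - x) := (inv_mul_cancel₀ hpos.ne').symm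
        _ ≤ ((k : ℝ) + 2) * (1 - x) := by gcongr
    rw [Real.smoothTransition.one_of_one_le h1, one_mul]

end PlateauLimit

/-! ## A Volterra step -/

section Volterra

/-- **Volterra lemma** (elementary real analysis). Let `n ≥ 1`, `g` continuous on `(0,∞)` with
`r^{n-1} g(r)` bounded on `(0,1]`, and suppose `g(ε) + 2 ∫_{(0,1]} x^{n-1} g(εx) dx → 0` as
`ε → 0⁺`. Then `∫_{(0,1]} x^{n-1} g(εx) dx → 0` (and hence `g(ε) → 0`) as `ε → 0⁺`.
Proof: with `H(ε) = ∫₀^ε r^{n-1} g(r) dr` one has `∫_{(0,1]} x^{n-1} g(εx) dx = ε^{-n} H(ε)` and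
`(ε² H)' = ε^{n+1} (g + 2ε^{-n} H)`, whence `|ε² H(ε)| ≤ η ε^{n+2}/(n+2)` as soon as
`|g + 2ε^{-n}H| ≤ η` on `(0, ε]`. [folklore] -/
theorem tendsto_volterra {n : ℕ} (hn : 1 ≤ n) {g : ℝ → ℝ} (hg : ContinuousOn g (Ioi 0)) {B : ℝ}
    (hB : ∀ r ∈ Ioc (0 : ℝ) 1, |r ^ (n - 1) * g r| ≤ B)
    (h : Tendsto (fun ε => g ε + 2 * ∫ x in Ioc (0 : ℝ) 1, x ^ (n - 1) * g (ε * x)) (𝓝[>] 0) (𝓝 0)) :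
    Tendsto (fun ε => ∫ x in Ioc (0 : ℝ) 1, x ^ (n - 1) * g (ε * x)) (𝓝[>] 0) (𝓝 0) := by
  -- the weighted function `f(r) = r^{n-1} g(r)` and its primitive `H`
  set f : ℝ → ℝ := fun r => r ^ (n - 1) * g r with hfdef
  have hfc : ContinuousOn f (Ioi 0) := ((continuous_pow (n - 1)).continuousOn).mul hg
  have hfint : ∀ b ∈ Ioc (0 : ℝ) 1, IntegrableOn f (Ioc 0 b) := by
    intro b hb
    refine IntegrableOn.of_bound measure_Ioc_lt_top
      ((hfc.mono Ioc_subset_Ioi_self).aestronglyMeasurable measurableSet_Ioc) B ?_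
    refine (ae_restrict_mem measurableSet_Ioc).mono fun r hr => ?_
    rw [Real.norm_eq_abs]
    exact hB r ⟨hr.1, hr.2.trans hb.2⟩
  have hfii : ∀ b ∈ Ioc (0 : ℝ) 1, IntervalIntegrable f volume 0 b := fun b hb =>
    (intervalIntegrable_iff_integrableOn_Ioc_of_le hb.1.le).2 (hfint b hb)
  set H : ℝ → ℝ := fun ε => ∫ r in (0 : ℝ)..ε, f r with hHdef
  set A : ℝ → ℝ := fun ε => ∫ x in Ioc (0 : ℝ) 1, x ^ (n - 1) * g (ε * x) with hAdef
  -- substitution: `A(ε) = ε^{-n} H(ε)` for `ε > 0`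
  have hsub : ∀ ε, 0 < ε → A ε = (ε ^ n)⁻¹ * H ε := by
    intro ε hε
    have hεn1 : (ε ^ (n - 1))⁻¹ * ε⁻¹ = (ε ^ n)⁻¹ := by
      rw [← mul_inv, pow_sub_one_mul (by omega) ε]
    have h1 : ∀ x : ℝ, x ^ (n - 1) * g (ε * x) = (ε ^ (n - 1))⁻¹ * f (ε * x) := by
      intro x
      simp only [hfdef, mul_pow]
      field_simp
    simp only [hAdef]
    rw [← intervalIntegral.integral_of_le zero_le_one]
    simp_rw [h1]
    rw [intervalIntegral.integral_const_mul, intervalIntegral.integral_comp_mul_left f hε.ne',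
      mul_zero, mul_one, smul_eq_mul, ← mul_assoc, hεn1]
  -- `|H(δ)| ≤ B δ` on `(0,1]`
  have hHle : ∀ δ ∈ Ioc (0 : ℝ) 1, |H δ| ≤ B * δ := by
    intro δ hδ
    have := intervalIntegral.norm_integral_le_of_norm_le_const (a := 0) (b := δ) (C := B) (f := f)
      fun x hx => by
        rw [uIoc_of_le hδ.1.le] at hx
        rw [Real.norm_eq_abs]
        exact hB x ⟨hx.1, hx.2.trans hδ.2⟩
    simpa [Real.norm_eq_abs, sub_zero, abs_of_pos hδ.1] using this
  -- `H` is differentiable on `(0,1)` with `H' = f`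
  have hHd : ∀ s ∈ Ioo (0 : ℝ) 1, HasDerivAt H (f s) s := by
    intro s hs
    refine intervalIntegral.integral_hasDerivAt_right (hfii s ⟨hs.1, hs.2.le⟩) ?_ ?_
    · exact hfc.stronglyMeasurableAtFilter isOpen_Ioi s hs.1
    · exact hfc.continuousAt (Ioi_mem_nhds hs.1)
  -- metric form of the hypothesis
  rw [Metric.tendsto_nhdsWithin_nhds] at h ⊢
  intro η hη
  obtain ⟨ε₁, hε₁, hη1⟩ := h (η / 2) (half_pos hη)
  set ε₀ : ℝ := min ε₁ 1 with hε₀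
  have hε₀pos : 0 < ε₀ := lt_min hε₁ one_pos
  refine ⟨ε₀, hε₀pos, fun ε hε hεd => ?_⟩
  have hε0 : 0 < ε := hε
  have hεε₀ : ε < ε₀ := by rwa [Real.dist_eq, sub_zero, abs_of_pos hε0] at hεd
  have hε1 : ε < 1 := hεε₀.trans_le (min_le_right _ _)
  have hεε₁ : ε < ε₁ := hεε₀.trans_le (min_le_left _ _)
  -- the bound `|g s + 2 A s| < η/2` on `(0, ε]`
  have hsmall : ∀ s, 0 < s → s ≤ ε → |g s + 2 * A s| < η / 2 := by
    intro s hs hsε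
    have := hη1 hs (by rw [Real.dist_eq, sub_zero, abs_of_pos hs]; exact hsε.trans_lt hεε₁)
    rwa [Real.dist_eq, sub_zero] at this
  -- FTC on `[δ, ε]` for `F(s) = s² H(s)`
  have hkey : ∀ δ ∈ Ioo 0 ε, |ε ^ 2 * H ε| ≤ B * δ ^ 3 + η / 2 * ε ^ (n + 2) / (n + 2) := by
    intro δ hδ
    have hδ1 : δ < 1 := hδ.2.trans hε1
    -- derivative of `F`
    have hF : ∀ s ∈ uIcc δ ε, HasDerivAt (fun s => s ^ 2 * H s) (2 * s * H s + s ^ 2 * f s) s := by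
      intro s hs
      rw [uIcc_of_le hδ.2.le] at hs
      have hs0 : 0 < s := hδ.1.trans_le hs.1
      have hs1 : s < 1 := hs.2.trans_lt hε1
      have h1 : HasDerivAt (fun s : ℝ => s ^ 2) (2 * s) s := by
        simpa using hasDerivAt_pow 2 s
      exact h1.fun_mul (hHd s ⟨hs0, hs1⟩)
    -- continuity of the derivative on `[δ, ε]`
    have hHc : ContinuousOn H (Icc δ ε) := fun s hs =>
      (hHd s ⟨hδ.1.trans_le hs.1, hs.2.trans_lt hε1⟩).continuousAt.continuousWithinAt
    have hF'c : ContinuousOn (fun s => 2 * s * H s + s ^ 2 * f s) (Icc δ ε) := by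
      refine ((continuous_const.mul continuous_id).continuousOn.mul hHc).add
        (((continuous_pow 2).continuousOn).mul (hfc.mono fun s hs => hδ.1.trans_le hs.1))
    have hF'i : IntervalIntegrable (fun s => 2 * s * H s + s ^ 2 * f s) volume δ ε :=
      (hF'c.mono (by rw [uIcc_of_le hδ.2.le])).intervalIntegrable
    have hFTC := intervalIntegral.integral_eq_sub_of_hasDerivAt hF hF'i
    -- the derivative is `s^{n+1} (g s + 2 A s)`, bounded by `(η/2) s^{n+1}`
    have hderiv_eq : ∀ s, 0 < s → 2 * s * H s + s ^ 2 * f s = s ^ (n + 1) * (g s + 2 * A s) := by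
      intro s hs
      rw [hsub s hs]
      simp only [hfdef]
      have hsn : s ^ n ≠ 0 := pow_ne_zero _ hs.ne'
      have hpow : s ^ 2 * s ^ (n - 1) = s ^ (n + 1) := by
        rw [← pow_add]; congr 1; omega
      have hpow2 : (2 : ℝ) * s = 2 * s ^ (n + 1) * (s ^ n)⁻¹ := by
        rw [pow_succ]; field_simp
      rw [hpow2]
      calc 2 * s ^ (n + 1) * (s ^ n)⁻¹ * H s + s ^ 2 * (s ^ (n - 1) * g s)
          = 2 * s ^ (n + 1) * (s ^ n)⁻¹ * H s + (s ^ 2 * s ^ (n - 1)) * g s := by ring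
        _ = s ^ (n + 1) * (g s + 2 * ((s ^ n)⁻¹ * H s)) := by rw [hpow]; ring
    have hbd : ‖∫ s in δ..ε, 2 * s * H s + s ^ 2 * f s‖ ≤ ∫ s in δ..ε, η / 2 * s ^ (n + 1) := by
      refine intervalIntegral.norm_integral_le_of_norm_le hδ.2.le (ae_of_all _ fun s hs => ?_) ?_
      · have hs0 : 0 < s := hδ.1.trans hs.1
        rw [hderiv_eq s hs0, Real.norm_eq_abs, abs_mul, abs_of_nonneg (pow_nonneg hs0.le _), mul_comm]
        exact mul_le_mul_of_nonneg_right (hsmall s hs0 hs.2).le (pow_nonneg hs0.le _)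
      · exact ((continuous_const.mul (continuous_pow _)).continuousOn).intervalIntegrable
    have hpoly : ∫ s in δ..ε, η / 2 * s ^ (n + 1) ≤ η / 2 * ε ^ (n + 2) / (n + 2) := by
      rw [intervalIntegral.integral_const_mul, integral_pow, mul_div_assoc]
      have hδp : 0 ≤ δ ^ (n + 1 + 1) := pow_nonneg hδ.1.le _
      have hn2 : (0 : ℝ) < (n : ℝ) + 1 + 1 := by positivity
      have hq : (ε ^ (n + 1 + 1) - δ ^ (n + 1 + 1)) / ((((n + 1 : ℕ)) : ℝ) + 1) ≤
          ε ^ (n + 2) / ((n : ℝ) + 2) := by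
        rw [show n + 1 + 1 = n + 2 from rfl]
        push_cast
        rw [show (n : ℝ) + 1 + 1 = (n : ℝ) + 2 by ring]
        exact div_le_div_of_nonneg_right (by linarith [pow_nonneg hδ.1.le (n + 2)]) (by positivity)
      exact mul_le_mul_of_nonneg_left hq (half_pos hη).le
    have hFδ : |δ ^ 2 * H δ| ≤ B * δ ^ 3 := by
      rw [abs_mul, abs_of_nonneg (sq_nonneg δ)]
      calc δ ^ 2 * |H δ| ≤ δ ^ 2 * (B * δ) := by
            gcongr; exact hHle δ ⟨hδ.1, hδ1.le⟩
        _ = B * δ ^ 3 := by ring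
    calc |ε ^ 2 * H ε| = |δ ^ 2 * H δ + ∫ s in δ..ε, 2 * s * H s + s ^ 2 * f s| := by
          rw [hFTC]; ring_nf
      _ ≤ |δ ^ 2 * H δ| + |∫ s in δ..ε, 2 * s * H s + s ^ 2 * f s| := abs_add_le _ _
      _ ≤ B * δ ^ 3 + η / 2 * ε ^ (n + 2) / (n + 2) := by
          refine add_le_add hFδ ?_
          rw [← Real.norm_eq_abs]
          exact hbd.trans hpoly
  -- let `δ → 0⁺`
  have hlim : |ε ^ 2 * H ε| ≤ η / 2 * ε ^ (n + 2) / (n + 2) := by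
    have ht : Tendsto (fun δ : ℝ => B * δ ^ 3 + η / 2 * ε ^ (n + 2) / (n + 2)) (𝓝[>] 0)
        (𝓝 (B * 0 ^ 3 + η / 2 * ε ^ (n + 2) / (n + 2))) :=
      ((tendsto_id.pow 3).const_mul B |>.add_const _).mono_left nhdsWithin_le_nhds
    rw [zero_pow three_ne_zero, mul_zero, zero_add] at ht
    exact ge_of_tendsto ht (by
      filter_upwards [Ioo_mem_nhdsGT hε0] with δ hδ using hkey δ hδ)
  -- conclude: `|A ε| ≤ (η/2)/(n+2) < η`
  have hnpos : (0 : ℝ) < (n : ℝ) + 2 := by positivity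
  have hA : |A ε| ≤ η / 2 / ((n : ℝ) + 2) := by
    rw [hsub ε hε0, abs_mul, abs_inv, abs_of_pos (pow_pos hε0 n)]
    have hε2 : 0 < ε ^ 2 := pow_pos hε0 2
    have h1 : |H ε| ≤ η / 2 * ε ^ (n + 2) / (n + 2) / ε ^ 2 := by
      rw [le_div_iff₀ hε2, mul_comm]
      rwa [abs_mul, abs_of_pos hε2] at hlim
    calc (ε ^ n)⁻¹ * |H ε| ≤ (ε ^ n)⁻¹ * (η / 2 * ε ^ (n + 2) / (n + 2) / ε ^ 2) := by
          gcongr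
      _ = η / 2 / ((n : ℝ) + 2) := by
          field_simp
          ring
  rw [Real.dist_eq, sub_zero]
  calc |A ε| ≤ η / 2 / ((n : ℝ) + 2) := hA
    _ ≤ η / 2 := div_le_self (half_pos hη).le (by linarith)
    _ < η := half_lt_self hη

end Volterra

/-! ## Limits along `ε → 0⁺` from uniform approximation -/

section UniformLimit

/-- If `P k ε → Λ ε` as `k → ∞` for each `ε > 0`, and `P k ε` is within `η` of `a` for all `k`
and all `ε ∈ (0, ε₀(η))`, then `Λ ε → a` as `ε → 0⁺`. [folklore] -/
theorem tendsto_nhdsGT_of_forall_tendsto_atTop {P : ℕ → ℝ → ℝ} {Λ : ℝ → ℝ} {a : ℝ}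
    (hU : ∀ η > 0, ∃ ε₀ > 0, ∀ k, ∀ ε ∈ Ioo (0 : ℝ) ε₀, |P k ε - a| < η)
    (hP : ∀ ε, 0 < ε → Tendsto (fun k => P k ε) atTop (𝓝 (Λ ε))) :
    Tendsto Λ (𝓝[>] 0) (𝓝 a) := by
  rw [Metric.tendsto_nhdsWithin_nhds]
  intro η hη
  obtain ⟨ε₀, hε₀, hb⟩ := hU (η / 2) (half_pos hη)
  refine ⟨ε₀, hε₀, fun ε hε hεd => ?_⟩
  have hε0 : 0 < ε := hε
  have hεI : ε ∈ Ioo 0 ε₀ := ⟨hε0, by rwa [Real.dist_eq, sub_zero, abs_of_pos hε0] at hεd⟩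
  have hlim : Tendsto (fun k => |P k ε - a|) atTop (𝓝 |Λ ε - a|) := ((hP ε hε0).sub_const a).abs
  have hle : |Λ ε - a| ≤ η / 2 := le_of_tendsto' hlim fun k => (hb k ε hεI).le
  rw [Real.dist_eq]
  linarith

end UniformLimit

/-! ## The 4/5 and 8/15 laws from a uniform Eyink defect -/

section FourFifths

variable {T : ℝ} {u : ℝ → UnitAddTorus d → EuclideanSpace ℝ d} {D : STFunctional d}

/-- **Shell limits from a uniform Eyink defect** (dimension `d ≥ 2`). If `u ∈ L³((0,T) × T^d)` is
jointly measurable and `D` is a uniform Eyink defect of `u` (`HasUniformEyinkDefect`), then for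
every test function `ψ` supported in `(0,T) × T^d` the longitudinal and mixed shell pairings
converge:
`∫₀ᵀ∫ ℓ⁻¹ ⨍ (δu_L(ℓω))³ dω ψ → −(12/(d(d+2))) D ψ` and
`∫₀ᵀ∫ ℓ⁻¹ ⨍ δu_L |δu_T|²(ℓω) dω ψ → −(4(d−1)/(d(d+2))) D ψ` as `ℓ → 0⁺` — the local 4/5 and 8/15
laws with the constants of Novack 2024, (1.6b)–(1.6c) (`−4/5`, `−8/15` for `d = 3`, Eyink 2003,
Cor. 1). See the module docstring for the proof (plateau mollifiers, the polar formula
`integral_eyinkApprox_eq`, un-averaging, and the Volterra step `tendsto_volterra`). [folklore] -/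
theorem HasUniformEyinkDefect.tendsto_shellPairings (hn2 : 2 ≤ Fintype.card d)
    (h : HasUniformEyinkDefect T u D)
    (hum : AEStronglyMeasurable (FunctionSpaces.Torus.stLift u) (volume.restrict (Ioo 0 T ×ˢ univ)))
    (hu3 : ∫⁻ t in Ioo 0 T, ∫⁻ x, ‖u t x‖ₑ ^ (3 : ℕ) < ∞)
    {ψ : ℝ → UnitAddTorus d → ℝ} (hψ : FunctionSpaces.Torus.IsSpaceTimeTestIoo T ψ) :
    Tendsto (fun ℓ => ∫ t in Ioo 0 T, ∫ x, ℓ⁻¹ * longitudinalFluxSphereAvg (u t) ℓ x * ψ t x)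
        (𝓝[>] 0) (𝓝 (-fourFifthsConst d * D ψ)) ∧
      Tendsto (fun ℓ => ∫ t in Ioo 0 T, ∫ x, ℓ⁻¹ * mixedFluxSphereAvg (u t) ℓ x * ψ t x)
        (𝓝[>] 0)
        (𝓝 (-(4 * ((Fintype.card d : ℝ) - 1) /
          ((Fintype.card d : ℝ) * ((Fintype.card d : ℝ) + 2))) * D ψ)) := by
  haveI : Nonempty d := Fintype.card_pos_iff.1 (by omega)
  -- product-measure form of the hypotheses
  set μp : Measure (ℝ × UnitAddTorus d) := (volume.restrict (Ioo 0 T)).prod volume with hμp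
  have hu : AEStronglyMeasurable (uncurry u) μp := aestronglyMeasurable_uncurry_prod_of_stLift_Ioo hum
  have hu3' : ∫⁻ p, ‖uncurry u p‖ₑ ^ 3 ∂μp < ∞ := lintegral_prod_enorm_pow_three_lt_top hu hu3
  have hψm : AEStronglyMeasurable (uncurry ψ) μp := hψ.continuous_uncurry.aestronglyMeasurable
  obtain ⟨Cψ, hψb⟩ := hψ.exists_abs_le
  -- the two cubic forms
  have hQLc : Continuous (uncurry fun (ω v : EuclideanSpace ℝ d) => ⟪v, ω⟫ ^ 3) := continuous_cubicFormL
  have hQL : ∀ ω v : EuclideanSpace ℝ d, ‖ω‖ ≤ 1 →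
      |(fun (ω v : EuclideanSpace ℝ d) => ⟪v, ω⟫ ^ 3) ω v| ≤ 1 * ‖v‖ ^ 3 :=
    fun ω v hω => abs_cubicFormL_le v hω
  have hQTc : Continuous (uncurry fun (ω v : EuclideanSpace ℝ d) => ⟪v, ω⟫ * ‖v - ⟪v, ω⟫ • ω‖ ^ 2) :=
    continuous_cubicFormT
  have hQT : ∀ ω v : EuclideanSpace ℝ d, ‖ω‖ ≤ 1 →
      |(fun (ω v : EuclideanSpace ℝ d) => ⟪v, ω⟫ * ‖v - ⟪v, ω⟫ • ω‖ ^ 2) ω v| ≤ 4 * ‖v‖ ^ 3 :=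
    fun ω v hω => abs_cubicFormT_le v hω
  have h4 : (0 : ℝ) ≤ 4 := by norm_num
  -- dimension, surface area, a unit vector
  set n : ℕ := Fintype.card d with hndef
  have hn1 : 1 ≤ n := by omega
  have hn0 : (0 : ℝ) < n := by exact_mod_cast (by omega : 0 < n)
  have hnR2 : (2 : ℝ) ≤ n := by exact_mod_cast hn2
  have hn0' : (n : ℝ) ≠ 0 := hn0.ne'
  have hn1' : (n : ℝ) - 1 ≠ 0 := by linarith
  have hn2' : (n : ℝ) + 2 ≠ 0 := by linarith
  set c : ℝ := (volume : Measure (EuclideanSpace ℝ d)).toSphere.real univ with hcdef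
  have hc : 0 < c := toSphere_real_univ_pos
  obtain ⟨e₀, he₀⟩ : ∃ e : EuclideanSpace ℝ d, ‖e‖ = 1 := by
    classical
    obtain ⟨i⟩ := ‹Nonempty d›
    exact ⟨EuclideanSpace.single i 1, by simp⟩
  -- the shell pairings (product form) and the shell functions `g_L`, `g_T`
  set IL : ℝ → ℝ := cubicShellPairing (fun (ω v : EuclideanSpace ℝ d) => ⟪v, ω⟫ ^ 3) T u ψ with hILdef
  set IT : ℝ → ℝ := cubicShellPairing
    (fun (ω v : EuclideanSpace ℝ d) => ⟪v, ω⟫ * ‖v - ⟪v, ω⟫ • ω‖ ^ 2) T u ψ with hITdef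
  set gL : ℝ → ℝ := fun r => r⁻¹ * IL r with hgLdef
  set gT : ℝ → ℝ := fun r => r⁻¹ * IT r with hgTdef
  have hgLiter : ∀ ℓ, ∫ t in Ioo 0 T, ∫ x, ℓ⁻¹ * longitudinalFluxSphereAvg (u t) ℓ x * ψ t x = gL ℓ :=
    fun ℓ => integral_integral_sphereAvg_eq hu hu3' hψm hψb hQLc zero_le_one hQL ℓ
  have hgTiter : ∀ ℓ, ∫ t in Ioo 0 T, ∫ x, ℓ⁻¹ * mixedFluxSphereAvg (u t) ℓ x * ψ t x = gT ℓ :=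
    fun ℓ => integral_integral_sphereAvg_eq hu hu3' hψm hψb hQTc h4 hQT ℓ
  have hILc : Continuous IL := continuous_cubicShellPairing_L hu hu3' hψm hψb
  have hITc : Continuous IT := continuous_cubicShellPairing_T hu hu3' hψm hψb
  have hgLc : ContinuousOn gL (Ioi 0) :=
    (continuousOn_inv₀.mono fun r hr => ne_of_gt hr).mul hILc.continuousOn
  have hgTc : ContinuousOn gT (Ioi 0) :=
    (continuousOn_inv₀.mono fun r hr => ne_of_gt hr).mul hITc.continuousOn
  -- integrability on `(0,1]` of `x ↦ x^{n-1} g_T(εx) = ε⁻¹ x^{n-2} I_T(εx)`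
  have hpow : ∀ x : ℝ, x ≠ 0 → x ^ (n - 1) * x⁻¹ = x ^ (n - 2) := by
    intro x hx
    have : x ^ (n - 1) = x ^ (n - 2) * x := by
      rw [← pow_succ]; congr 1; omega
    rw [this, mul_assoc, mul_inv_cancel₀ hx, mul_one]
  have hAint : ∀ ε, 0 < ε → IntegrableOn (fun x => x ^ (n - 1) * gT (ε * x)) (Ioc 0 1) := by
    intro ε hε
    obtain ⟨M, hM⟩ := (isCompact_Icc (a := (0 : ℝ)) (b := ε)).exists_bound_of_continuousOn
      hITc.continuousOn
    have hcont : ContinuousOn (fun x => x ^ (n - 1) * gT (ε * x)) (Ioc 0 1) :=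
      ((continuous_pow _).continuousOn).mul
        ((hgTc.comp (continuous_const.mul continuous_id).continuousOn
          fun x hx => mul_pos hε hx).mono Ioc_subset_Ioi_self)
    refine IntegrableOn.of_bound measure_Ioc_lt_top (hcont.aestronglyMeasurable measurableSet_Ioc)
      (ε⁻¹ * M) ?_
    refine (ae_restrict_mem measurableSet_Ioc).mono fun x hx => ?_
    have hx0 : 0 < x := hx.1
    have hεx : 0 < ε * x := mul_pos hε hx0
    have heq : x ^ (n - 1) * gT (ε * x) = ε⁻¹ * (x ^ (n - 2) * IT (ε * x)) := by
      simp only [hgTdef]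
      rw [mul_inv, ← hpow x hx0.ne']
      ring
    rw [heq, norm_mul, Real.norm_eq_abs, abs_of_pos (inv_pos.2 hε), norm_mul, Real.norm_eq_abs,
      abs_of_nonneg (pow_nonneg hx0.le _)]
    gcongr
    calc x ^ (n - 2) * ‖IT (ε * x)‖ ≤ 1 * M := by
          gcongr
          · exact pow_le_one₀ hx0.le hx.2
          · exact hM _ ⟨hεx.le, by nlinarith [hx.2]⟩
      _ = M := one_mul M
  -- the ball average `A(ε) = ∫_{(0,1]} x^{n-1} g_T(εx) dx`
  set A : ℝ → ℝ := fun ε => ∫ x in Ioc (0 : ℝ) 1, x ^ (n - 1) * gT (ε * x) with hAdef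
  -- Step 1: the plateau mollifiers; polar formula and the `k → ∞` limits at fixed `ε > 0`
  have hm : ∀ k : ℕ, (1 : ℝ) < (k : ℝ) + 2 := fun k => by
    have : (0 : ℝ) ≤ k := Nat.cast_nonneg k
    linarith
  set PL : ℕ → ℝ → ℝ := fun k ε =>
    ∫ t in Ioo 0 T, ∫ x, eyinkLongitudinalApprox (plateauMollifier d ((k : ℝ) + 2)) ε (u t) x * ψ t x
    with hPLdef
  set PT : ℕ → ℝ → ℝ := fun k ε =>
    ∫ t in Ioo 0 T, ∫ x, eyinkTransverseApprox (plateauMollifier d ((k : ℝ) + 2)) ε (u t) x * ψ t x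
    with hPTdef
  set J1L : ℕ → ℝ → ℝ := fun k ε => ∫ x in Ioi (0 : ℝ), x ^ n *
    deriv (fun s : ℝ => plateauMollifier d ((k : ℝ) + 2) (s • e₀)) x * gL (ε * x) with hJ1Ldef
  set J1T : ℕ → ℝ → ℝ := fun k ε => ∫ x in Ioi (0 : ℝ), x ^ n *
    deriv (fun s : ℝ => plateauMollifier d ((k : ℝ) + 2) (s • e₀)) x * gT (ε * x) with hJ1Tdef
  set J2 : ℕ → ℝ → ℝ := fun k ε => ∫ x in Ioi (0 : ℝ), 2 * x ^ (n - 1) *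
    plateauMollifier d ((k : ℝ) + 2) (x • e₀) * gT (ε * x) with hJ2def
  have hP : ∀ (k : ℕ) (ε : ℝ), 0 < ε →
      PL k ε = eyinkLongitudinalConst d * c * (J1L k ε + J2 k ε) ∧
        PT k ε = eyinkTransverseConst d * c * (J1T k ε - J2 k ε) := fun k ε hε =>
    integral_eyinkApprox_eq hn2 (isUnitBallMollifier_plateauMollifier (hm k)).1
      (fun x y hxy => plateauMollifier_radial _ hxy) (isUnitBallMollifier_plateauMollifier (hm k)).2
      he₀ hu hu3' hψm hψb hε
  have hJ1L : ∀ ε, 0 < ε → Tendsto (fun k => J1L k ε) atTop (𝓝 (-(n : ℝ) / c * gL ε)) :=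
    fun ε hε => tendsto_integral_pow_mul_deriv_profile_mul he₀ hgLc hε
  have hJ1T : ∀ ε, 0 < ε → Tendsto (fun k => J1T k ε) atTop (𝓝 (-(n : ℝ) / c * gT ε)) :=
    fun ε hε => tendsto_integral_pow_mul_deriv_profile_mul he₀ hgTc hε
  have hJ2 : ∀ ε, 0 < ε → Tendsto (fun k => J2 k ε) atTop (𝓝 ((n : ℝ) / c * (2 * A ε))) := by
    intro ε hε
    have hH : IntegrableOn (fun x => 2 * (x ^ (n - 1) * gT (ε * x))) (Ioc 0 1) :=
      (hAint ε hε).const_mul 2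
    have hlim := tendsto_integral_plateauMollifier_profile_mul he₀ hH
    have h2A : ∫ x in Ioc (0 : ℝ) 1, 2 * (x ^ (n - 1) * gT (ε * x)) = 2 * A ε := integral_const_mul _ _
    rw [h2A] at hlim
    refine hlim.congr fun k => ?_
    simp only [hJ2def]
    refine setIntegral_congr_fun measurableSet_Ioi fun x _ => ?_
    ring
  have hPLlim : ∀ ε, 0 < ε → Tendsto (fun k => PL k ε) atTop
      (𝓝 (eyinkLongitudinalConst d * c * (-(n : ℝ) / c * gL ε + (n : ℝ) / c * (2 * A ε)))) := by
    intro ε hε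
    refine (((hJ1L ε hε).add (hJ2 ε hε)).const_mul (eyinkLongitudinalConst d * c)).congr fun k => ?_
    exact ((hP k ε hε).1).symm
  have hPTlim : ∀ ε, 0 < ε → Tendsto (fun k => PT k ε) atTop
      (𝓝 (eyinkTransverseConst d * c * (-(n : ℝ) / c * gT ε - (n : ℝ) / c * (2 * A ε)))) := by
    intro ε hε
    refine (((hJ1T ε hε).sub (hJ2 ε hε)).const_mul (eyinkTransverseConst d * c)).congr fun k => ?_
    exact ((hP k ε hε).2).symm
  -- Step 2: uniformity in the mollifier ⇒ the `ε → 0⁺` limits of the right-hand sides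
  have hUL : ∀ η > 0, ∃ ε₀ > 0, ∀ k, ∀ ε ∈ Ioo (0 : ℝ) ε₀, |PL k ε - D ψ| < η := by
    intro η hη
    obtain ⟨ε₀, hε₀, hb⟩ := h.exists_forall_abs_sub_lt hψ hη
    exact ⟨ε₀, hε₀, fun k ε hε => (hb _ (isRadialUnitBallMollifier_plateauMollifier (hm k)) ε hε).1⟩
  have hUT : ∀ η > 0, ∃ ε₀ > 0, ∀ k, ∀ ε ∈ Ioo (0 : ℝ) ε₀, |PT k ε - D ψ| < η := by
    intro η hη
    obtain ⟨ε₀, hε₀, hb⟩ := h.exists_forall_abs_sub_lt hψ hη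
    exact ⟨ε₀, hε₀, fun k ε hε => (hb _ (isRadialUnitBallMollifier_plateauMollifier (hm k)) ε hε).2⟩
  have hΛL := tendsto_nhdsGT_of_forall_tendsto_atTop hUL hPLlim
  have hΛT := tendsto_nhdsGT_of_forall_tendsto_atTop hUT hPTlim
  -- Step 3: the two relations
  have hE1 : Tendsto (fun ε => -gL ε + 2 * A ε) (𝓝[>] 0) (𝓝 (4 / (n : ℝ) ^ 2 * D ψ)) := by
    refine (hΛL.const_mul (4 / (n : ℝ) ^ 2)).congr fun ε => ?_
    simp only [eyinkLongitudinalConst, ← hndef]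
    field_simp
  have hE2 : Tendsto (fun ε => gT ε + 2 * A ε) (𝓝[>] 0)
      (𝓝 (-(4 * ((n : ℝ) - 1) / (n : ℝ) ^ 2) * D ψ)) := by
    refine (hΛT.const_mul (-(4 * ((n : ℝ) - 1) / (n : ℝ) ^ 2))).congr fun ε => ?_
    simp only [eyinkTransverseConst, ← hndef]
    field_simp
    ring
  -- Step 4: the Volterra step for `g = g_T − L_T`
  set LT : ℝ := -(4 * ((n : ℝ) - 1) / ((n : ℝ) * ((n : ℝ) + 2))) * D ψ with hLTdef
  set g : ℝ → ℝ := fun r => gT r - LT with hgdef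
  have hgc : ContinuousOn g (Ioi 0) := hgTc.sub continuousOn_const
  obtain ⟨M, hM⟩ := (isCompact_Icc (a := (0 : ℝ)) (b := 1)).exists_bound_of_continuousOn
    hITc.continuousOn
  have hbd : ∀ r ∈ Ioc (0 : ℝ) 1, |r ^ (n - 1) * g r| ≤ M + |LT| := by
    intro r hr
    have hr0 : 0 < r := hr.1
    have heq : r ^ (n - 1) * g r = r ^ (n - 2) * IT r - r ^ (n - 1) * LT := by
      simp only [hgdef, hgTdef]
      rw [mul_sub, ← mul_assoc, hpow r hr0.ne']
    rw [heq]
    calc |r ^ (n - 2) * IT r - r ^ (n - 1) * LT| ≤ |r ^ (n - 2) * IT r| + |r ^ (n - 1) * LT| :=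
          abs_sub _ _
      _ = r ^ (n - 2) * |IT r| + r ^ (n - 1) * |LT| := by
          rw [abs_mul, abs_mul, abs_of_nonneg (pow_nonneg hr0.le _), abs_of_nonneg (pow_nonneg hr0.le _)]
      _ ≤ 1 * M + 1 * |LT| := by
          have hITr : |IT r| ≤ M := by
            have := hM r ⟨hr0.le, hr.2⟩
            rwa [Real.norm_eq_abs] at this
          gcongr
          · exact pow_le_one₀ hr0.le hr.2
          · exact pow_le_one₀ hr0.le hr.2
      _ = M + |LT| := by ring
  have hpowint : ∫ x in Ioc (0 : ℝ) 1, x ^ (n - 1) = 1 / n := by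
    rw [← intervalIntegral.integral_of_le zero_le_one, integral_pow]
    rw [one_pow, zero_pow (by omega), sub_zero, Nat.cast_sub hn1]
    push_cast
    ring
  have hAg : ∀ ε, 0 < ε → ∫ x in Ioc (0 : ℝ) 1, x ^ (n - 1) * g (ε * x) = A ε - LT / n := by
    intro ε hε
    have hi1 := hAint ε hε
    have hi2 : IntegrableOn (fun x : ℝ => x ^ (n - 1) * LT) (Ioc 0 1) :=
      ((continuous_pow _).mul continuous_const).continuousOn.integrableOn_compact isCompact_Icc
        |>.mono_set Ioc_subset_Icc_self
    have heq : (fun x => x ^ (n - 1) * g (ε * x)) = fun x => x ^ (n - 1) * gT (ε * x) - x ^ (n - 1) * LT := by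
      funext x; simp only [hgdef]; ring
    rw [heq, integral_sub hi1 hi2, integral_mul_const, hpowint]
    ring
  have hVhyp : Tendsto (fun ε => g ε + 2 * ∫ x in Ioc (0 : ℝ) 1, x ^ (n - 1) * g (ε * x))
      (𝓝[>] 0) (𝓝 0) := by
    have h1 : Tendsto (fun ε => (gT ε + 2 * A ε) - LT * (1 + 2 / n)) (𝓝[>] 0)
        (𝓝 (-(4 * ((n : ℝ) - 1) / (n : ℝ) ^ 2) * D ψ - LT * (1 + 2 / n))) := hE2.sub_const _
    have h0 : -(4 * ((n : ℝ) - 1) / (n : ℝ) ^ 2) * D ψ - LT * (1 + 2 / n) = 0 := by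
      simp only [hLTdef]
      field_simp
      ring
    rw [h0] at h1
    refine h1.congr' ?_
    filter_upwards [self_mem_nhdsWithin] with ε hε
    rw [hAg ε hε]
    simp only [hgdef]
    field_simp
    ring
  have hV := tendsto_volterra hn1 hgc hbd hVhyp
  -- Step 5: conclusions
  have hAlim : Tendsto A (𝓝[>] 0) (𝓝 (LT / n)) := by
    have h1 := hV.add_const (LT / n)
    rw [zero_add] at h1
    refine h1.congr' ?_
    filter_upwards [self_mem_nhdsWithin] with ε hε
    rw [hAg ε hε]
    ring
  have hgTlim : Tendsto gT (𝓝[>] 0) (𝓝 LT) := by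
    have h1 := hE2.sub (hAlim.const_mul 2)
    have h0 : -(4 * ((n : ℝ) - 1) / (n : ℝ) ^ 2) * D ψ - 2 * (LT / n) = LT := by
      simp only [hLTdef]
      field_simp
      ring
    rw [h0] at h1
    exact h1.congr fun ε => by ring
  have hgLlim : Tendsto gL (𝓝[>] 0) (𝓝 (-fourFifthsConst d * D ψ)) := by
    have h1 := (hAlim.const_mul 2).sub hE1
    have h0 : 2 * (LT / n) - 4 / (n : ℝ) ^ 2 * D ψ = -fourFifthsConst d * D ψ := by
      simp only [hLTdef, fourFifthsConst, ← hndef]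
      field_simp
      ring
    rw [h0] at h1
    exact h1.congr fun ε => by ring
  refine ⟨?_, ?_⟩
  · rw [tendsto_congr hgLiter]
    exact hgLlim
  · rw [tendsto_congr hgTiter]
    exact hgTlim

/-- **The local 4/5 law from a uniform Eyink defect** (dimension `d ≥ 2`): if `u ∈ L³((0,T) × T^d)`
is jointly measurable and `D` is a uniform Eyink defect of `u`, then
`Torus.HasFourFifthsLaw T u D`: `lim_{ℓ→0⁺} ∫₀ᵀ∫ ℓ⁻¹ ⨍ (δ_L u(ℓω))³ dω ψ = −(12/(d(d+2))) D ψ` for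
every test function `ψ` (Eyink 2003, Cor. 1 with `−4/5` in `d = 3`; Novack 2024, Thm. 1, (1.6b)). [folklore] -/
theorem HasUniformEyinkDefect.hasFourFifthsLaw (hn2 : 2 ≤ Fintype.card d)
    (h : HasUniformEyinkDefect T u D)
    (hum : AEStronglyMeasurable (FunctionSpaces.Torus.stLift u) (volume.restrict (Ioo 0 T ×ˢ univ)))
    (hu3 : ∫⁻ t in Ioo 0 T, ∫⁻ x, ‖u t x‖ₑ ^ (3 : ℕ) < ∞) :
    HasFourFifthsLaw T u D :=
  fun _ hψ => (h.tendsto_shellPairings hn2 hum hu3 hψ).1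

/-- **The local 8/15 law from a uniform Eyink defect** (dimension `d ≥ 2`): under the hypotheses
of `hasFourFifthsLaw`, the mixed shell pairing converges,
`∫₀ᵀ∫ ℓ⁻¹ ⨍ δu_L |δu_T|²(ℓω) dω ψ → −(4(d−1)/(d(d+2))) D ψ` as `ℓ → 0⁺` (`−8/15 D ψ` for `d = 3`,
Eyink 2003, Cor. 1; Novack 2024, Thm. 1, (1.6c)). [folklore] -/
theorem HasUniformEyinkDefect.tendsto_mixedFlux (hn2 : 2 ≤ Fintype.card d)
    (h : HasUniformEyinkDefect T u D)
    (hum : AEStronglyMeasurable (FunctionSpaces.Torus.stLift u) (volume.restrict (Ioo 0 T ×ˢ univ)))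
    (hu3 : ∫⁻ t in Ioo 0 T, ∫⁻ x, ‖u t x‖ₑ ^ (3 : ℕ) < ∞)
    {ψ : ℝ → UnitAddTorus d → ℝ} (hψ : FunctionSpaces.Torus.IsSpaceTimeTestIoo T ψ) :
    Tendsto (fun ℓ => ∫ t in Ioo 0 T, ∫ x, ℓ⁻¹ * mixedFluxSphereAvg (u t) ℓ x * ψ t x) (𝓝[>] 0)
      (𝓝 (-(4 * ((Fintype.card d : ℝ) - 1) /
        ((Fintype.card d : ℝ) * ((Fintype.card d : ℝ) + 2))) * D ψ)) :=
  (h.tendsto_shellPairings hn2 hum hu3 hψ).2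

/-- Two functionals that agree on test functions supported in `(0,T)` have the same uniform Eyink
defects. [folklore] -/
theorem HasUniformEyinkDefect.congr_defect {D' : STFunctional d} (h : HasUniformEyinkDefect T u D)
    (hDD' : ∀ ψ : ℝ → UnitAddTorus d → ℝ, FunctionSpaces.Torus.IsSpaceTimeTestIoo T ψ → D ψ = D' ψ) :
    HasUniformEyinkDefect T u D' := by
  intro ψ hψ
  have := h ψ hψ
  rw [hDD' ψ hψ] at this
  exact this

end FourFifths

/-! ## The predicate is a notion: inhabitants, uniqueness of the defect, non-inhabitants -/

section Examples

variable {T : ℝ} {u : ℝ → UnitAddTorus d → EuclideanSpace ℝ d} {D D' : STFunctional d}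

/-- For the fluid at rest both of Eyink's mollified fluxes vanish identically:
`D_L^{ε,φ}(0) = 0`. [folklore] -/
@[simp]
theorem eyinkLongitudinalApprox_zero_velocity (φ : EuclideanSpace ℝ d → ℝ) (ε : ℝ)
    (x : UnitAddTorus d) :
    eyinkLongitudinalApprox φ ε (0 : UnitAddTorus d → EuclideanSpace ℝ d) x = 0 := by
  simp [eyinkLongitudinalApprox, eyinkLongitudinalIntegrand, longitudinalIncrement, increment]

/-- For the fluid at rest both of Eyink's mollified fluxes vanish identically:
`D_T^{ε,φ}(0) = 0`. [folklore] -/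
@[simp]
theorem eyinkTransverseApprox_zero_velocity (φ : EuclideanSpace ℝ d → ℝ) (ε : ℝ)
    (x : UnitAddTorus d) :
    eyinkTransverseApprox φ ε (0 : UnitAddTorus d → EuclideanSpace ℝ d) x = 0 := by
  simp [eyinkTransverseApprox, eyinkTransverseIntegrand, longitudinalIncrement, transverseIncrement,
    increment]

variable (T) in
/-- **Non-vacuity.** The fluid at rest has the zero functional as a uniform Eyink defect:
`HasUniformEyinkDefect T 0 0` (all increments vanish, so both pairings are identically `0`).
[folklore] -/
theorem hasUniformEyinkDefect_zero :
    HasUniformEyinkDefect T (0 : ℝ → UnitAddTorus d → EuclideanSpace ℝ d) (0 : STFunctional d) := by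
  intro ψ _
  have h0 : TendstoUniformlyOn (fun (_ : ℝ) (_ : EuclideanSpace ℝ d → ℝ) => (0 : ℝ))
      (fun _ => (0 : ℝ)) (𝓝[>] 0) {φ | IsRadialUnitBallMollifier φ} :=
    ((tendsto_const_nhds (x := (0 : ℝ))).tendstoUniformly_const
      (α := EuclideanSpace ℝ d → ℝ)).tendstoUniformlyOn
  refine ⟨?_, ?_⟩
  · simpa using h0
  · simpa using h0

/-- **The uniform Eyink defect is unique on test functions** (`d` nonempty, so that radial
unit-ball mollifiers exist, e.g. the plateau mollifier `φ₂`): two uniform Eyink defects of the same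
`u` agree on every test function supported in `(0,T)`, both being the limit of the same pairings
along the proper filter `𝓝[>] 0`. [folklore] -/
theorem HasUniformEyinkDefect.unique [Nonempty d] (h : HasUniformEyinkDefect T u D)
    (h' : HasUniformEyinkDefect T u D') {ψ : ℝ → UnitAddTorus d → ℝ}
    (hψ : FunctionSpaces.Torus.IsSpaceTimeTestIoo T ψ) : D ψ = D' ψ :=
  tendsto_nhds_unique (h.tendsto (isRadialUnitBallMollifier_plateauMollifier one_lt_two) hψ).1
    (h'.tendsto (isRadialUnitBallMollifier_plateauMollifier one_lt_two) hψ).1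

variable (T) in
/-- **A non-inhabitant.** A nonzero constant functional is not a uniform Eyink defect of the fluid
at rest (`d` nonempty): by `hasUniformEyinkDefect_zero` and uniqueness, tested on `ψ = 0`. In
particular `HasUniformEyinkDefect` is a genuine predicate on `(T, u, D)`, not a closed proposition:
`∀ T u D, HasUniformEyinkDefect T u D` is false. [folklore] -/
theorem not_hasUniformEyinkDefect_zero_const [Nonempty d] {c : ℝ} (hc : c ≠ 0) :
    ¬ HasUniformEyinkDefect T (0 : ℝ → UnitAddTorus d → EuclideanSpace ℝ d) (fun _ => c) := by
  intro h
  have hψ0 : FunctionSpaces.Torus.IsSpaceTimeTestIoo T (0 : ℝ → UnitAddTorus d → ℝ) :=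
    ⟨FunctionSpaces.Torus.isSpaceTimeTest_zero T, 1, one_pos, fun _ _ => rfl⟩
  exact hc (by simpa using h.unique (hasUniformEyinkDefect_zero T) hψ0)

end Examples

end Literature.Analysis.FluidPDE.Torus
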